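import Mathlib

/-!
# Clause 13-J/13-R, brick n3 (PROFILE BUMPS): the smooth plateau profiles of the five windows and the one-sided band profile

Route `FilamentSkeletonRss`, ∃-side clause 13 (`Clause13RNearStraightL` stmt-NavierStokesRegularity-23612; typing-agnostic); design
`filament-plan/DESIGN-28296-model-gluing-g16-v2-addendum.md` §A (the five pieces).  Pure real analysis, no Fourier theory: with Mathlib's
`Real.smoothTransition` (`= 0` on `x ≤ 0`, `= 1` on `x ≥ 1`, smooth) the STEP-DOWN `x ↦ smoothTransition((β − x)/(β − α))` is `1` for `x ≤ α` and `0`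
for `x ≥ β`, and the PLATEAU PROFILE
  `P_{α,β}(x) = smoothTransition((β − x)/(β − α)) + smoothTransition((β + x)/(β − α)) − 1`   (`0 ≤ α < β`)
is smooth, even, `= 1` on `|x| ≤ α`, `= 0` on `|x| ≥ β`, with derivative supported in `α ≤ |x| ≤ β` (§1–§2); the ONE-SIDED BAND PROFILE
  `V(x) = smoothTransition((18/5 − x)/(18/5 − 7/2)) − smoothTransition((19/20 − x)/(19/20 − 17/20))`
is smooth, vanishes off `(17/20, 18/5)`, and `P_{7/2,18/5} − P_{17/20,19/20} = V + V(−·)` (§3) — the partition identity behind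
`k_N = k_S0 + k_S1 + 2a + k_M` of `model_l2_estimate`.  No definitions are introduced (the profiles are written out in each statement).
Lane ns-filament-19175-p1 g17; `--supports stmt-NavierStokesRegularity-23612 --as helper`.
HONEST FRAMING: calculus of explicit cut-off functions for a HYPOTHETICAL filament skeleton's model operator on the NEGATIVE side of a MODEL route; nothing
here bears on Navier–Stokes regularity or blow-up.
-/

noncomputable section

open Real Set Filter
open scoped Topology

namespace Summit.NavierStokesRegularity.NavierStokesRegularity.Theorems.MatchedKernel
set_option linter.dupNamespace false

/-! ## §1 The step-down and the plateau profile: smoothness, values, parity, support -/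

/-- The step-down `smoothTransition((β − x)/(β − α))` is smooth. [folklore] -/
theorem contDiff_stepDown (α β : ℝ) : ContDiff ℝ ((⊤ : ℕ∞) : WithTop ℕ∞) fun x : ℝ => smoothTransition ((β - x) / (β - α)) :=
  smoothTransition.contDiff.comp ((contDiff_const.sub contDiff_id).div_const _)

/-- The step-down is `1` for `x ≤ α` (`α < β`). [folklore] -/
theorem stepDown_eq_one {α β x : ℝ} (h : α < β) (hx : x ≤ α) : smoothTransition ((β - x) / (β - α)) = 1 :=
  smoothTransition.one_of_one_le (by rw [le_div_iff₀ (by linarith)]; linarith)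

/-- The step-down is `0` for `β ≤ x` (`α < β`). [folklore] -/
theorem stepDown_eq_zero {α β x : ℝ} (h : α < β) (hx : β ≤ x) : smoothTransition ((β - x) / (β - α)) = 0 :=
  smoothTransition.zero_of_nonpos (div_nonpos_of_nonpos_of_nonneg (by linarith) (by linarith))

/-- **The plateau profile is smooth.** [folklore] -/
theorem contDiff_plateau (α β : ℝ) :
    ContDiff ℝ ((⊤ : ℕ∞) : WithTop ℕ∞) fun x : ℝ => smoothTransition ((β - x) / (β - α)) + smoothTransition ((β + x) / (β - α)) - 1 :=
  ((contDiff_stepDown α β).add (smoothTransition.contDiff.comp ((contDiff_const.add contDiff_id).div_const _))).sub contDiff_const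

/-- **Plateau: `= 1` on `|x| ≤ α`.** [folklore] -/
theorem plateau_eq_one {α β x : ℝ} (h : α < β) (hx : |x| ≤ α) :
    smoothTransition ((β - x) / (β - α)) + smoothTransition ((β + x) / (β - α)) - 1 = 1 := by
  have h1 := stepDown_eq_one h (le_of_abs_le hx)
  have h2 : smoothTransition ((β + x) / (β - α)) = 1 := by
    have := stepDown_eq_one (x := -x) h (by linarith [neg_abs_le x] : -x ≤ α)
    rwa [sub_neg_eq_add] at this
  rw [h1, h2]; ring

/-- **Plateau: `= 0` on `β ≤ |x|`** (`0 ≤ α < β`). [folklore] -/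
theorem plateau_eq_zero {α β x : ℝ} (hα : 0 ≤ α) (h : α < β) (hx : β ≤ |x|) :
    smoothTransition ((β - x) / (β - α)) + smoothTransition ((β + x) / (β - α)) - 1 = 0 := by
  rcases le_or_gt 0 x with hx0 | hx0
  · rw [abs_of_nonneg hx0] at hx
    have h1 := stepDown_eq_zero h hx
    have h2 : smoothTransition ((β + x) / (β - α)) = 1 :=
      smoothTransition.one_of_one_le (by rw [le_div_iff₀ (by linarith)]; linarith)
    rw [h1, h2]; ring
  · rw [abs_of_neg hx0] at hx
    have h1 : smoothTransition ((β - x) / (β - α)) = 1 :=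
      smoothTransition.one_of_one_le (by rw [le_div_iff₀ (by linarith)]; linarith)
    have h2 : smoothTransition ((β + x) / (β - α)) = 0 :=
      smoothTransition.zero_of_nonpos (div_nonpos_of_nonpos_of_nonneg (by linarith) (by linarith))
    rw [h1, h2]; ring

/-- **Plateau is even.** [folklore] -/
theorem plateau_neg (α β x : ℝ) :
    smoothTransition ((β - -x) / (β - α)) + smoothTransition ((β + -x) / (β - α)) - 1
      = smoothTransition ((β - x) / (β - α)) + smoothTransition ((β + x) / (β - α)) - 1 := by
  rw [sub_neg_eq_add, ← sub_eq_add_neg]; ring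

/-- Plateau `≠ 0 ⟹ |x| < β`. [folklore] -/
theorem abs_lt_of_plateau_ne_zero {α β x : ℝ} (hα : 0 ≤ α) (h : α < β)
    (hx : smoothTransition ((β - x) / (β - α)) + smoothTransition ((β + x) / (β - α)) - 1 ≠ 0) : |x| < β := by
  by_contra hc
  exact hx (plateau_eq_zero hα h (not_lt.1 hc))

/-- Plateau `≠ 1 ⟹ α < |x|`. [folklore] -/
theorem lt_abs_of_plateau_ne_one {α β x : ℝ} (h : α < β)
    (hx : smoothTransition ((β - x) / (β - α)) + smoothTransition ((β + x) / (β - α)) - 1 ≠ 1) : α < |x| := by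
  by_contra hc
  exact hx (plateau_eq_one h (not_lt.1 hc))

/-- **Plateau has compact support** (`0 ≤ α < β`). [folklore] -/
theorem hasCompactSupport_plateau {α β : ℝ} (hα : 0 ≤ α) (h : α < β) :
    HasCompactSupport fun x : ℝ => smoothTransition ((β - x) / (β - α)) + smoothTransition ((β + x) / (β - α)) - 1 := by
  refine HasCompactSupport.of_support_subset_isCompact (isCompact_Icc (a := -β) (b := β)) fun x hx => ?_
  have hlt := abs_lt_of_plateau_ne_zero hα h (Function.mem_support.1 hx)
  exact ⟨by linarith [neg_abs_le x], by linarith [le_abs_self x]⟩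

/-! ## §2 The derivative of the plateau lives in `α ≤ |x| ≤ β` -/

/-- **`deriv P_{α,β}(x) ≠ 0 ⟹ α ≤ |x| ≤ β`** (the profile is locally constant off that annulus). [folklore] -/
theorem plateau_deriv_support {α β x : ℝ} (hα : 0 ≤ α) (h : α < β)
    (hx : deriv (fun x : ℝ => smoothTransition ((β - x) / (β - α)) + smoothTransition ((β + x) / (β - α)) - 1) x ≠ 0) :
    α ≤ |x| ∧ |x| ≤ β := by
  set P : ℝ → ℝ := fun x : ℝ => smoothTransition ((β - x) / (β - α)) + smoothTransition ((β + x) / (β - α)) - 1 with hP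
  constructor
  · by_contra hc
    push Not at hc
    -- `P = 1` near `x`
    have hev : P =ᶠ[𝓝 x] fun _ => (1 : ℝ) := by
      have hopen : IsOpen {y : ℝ | |y| < α} := isOpen_lt continuous_abs continuous_const
      filter_upwards [hopen.mem_nhds hc] with y hy
      exact plateau_eq_one h (le_of_lt hy)
    exact hx (by rw [hev.deriv_eq, deriv_const])
  · by_contra hc
    push Not at hc
    have hev : P =ᶠ[𝓝 x] fun _ => (0 : ℝ) := by
      have hopen : IsOpen {y : ℝ | β < |y|} := isOpen_lt continuous_const continuous_abs
      filter_upwards [hopen.mem_nhds hc] with y hy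
      exact plateau_eq_zero hα h (le_of_lt hy)
    exact hx (by rw [hev.deriv_eq, deriv_const])

/-- The plateau is differentiable with `HasDerivAt P (deriv P x) x`. [folklore] -/
theorem hasDerivAt_plateau (α β x : ℝ) :
    HasDerivAt (fun x : ℝ => smoothTransition ((β - x) / (β - α)) + smoothTransition ((β + x) / (β - α)) - 1)
      (deriv (fun x : ℝ => smoothTransition ((β - x) / (β - α)) + smoothTransition ((β + x) / (β - α)) - 1) x) x :=
  (((contDiff_plateau α β).differentiable (by simp)).differentiableAt).hasDerivAt

/-! ## §3 The one-sided band profile -/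

/-- **The band profile is smooth.** [folklore] -/
theorem contDiff_bandProfile :
    ContDiff ℝ ((⊤ : ℕ∞) : WithTop ℕ∞) fun x : ℝ =>
      smoothTransition ((18 / 5 - x) / (18 / 5 - 7 / 2)) - smoothTransition ((19 / 20 - x) / (19 / 20 - 17 / 20)) :=
  (contDiff_stepDown (7 / 2) (18 / 5)).sub (contDiff_stepDown (17 / 20) (19 / 20))

/-- The band profile vanishes for `x ≤ 17/20`. [folklore] -/
theorem bandProfile_eq_zero_of_le {x : ℝ} (hx : x ≤ 17 / 20) :
    smoothTransition ((18 / 5 - x) / (18 / 5 - 7 / 2)) - smoothTransition ((19 / 20 - x) / (19 / 20 - 17 / 20)) = 0 := by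
  rw [stepDown_eq_one (by norm_num) (by linarith : x ≤ 7 / 2), stepDown_eq_one (by norm_num) hx]; ring

/-- The band profile vanishes for `18/5 ≤ x`. [folklore] -/
theorem bandProfile_eq_zero_of_ge {x : ℝ} (hx : 18 / 5 ≤ x) :
    smoothTransition ((18 / 5 - x) / (18 / 5 - 7 / 2)) - smoothTransition ((19 / 20 - x) / (19 / 20 - 17 / 20)) = 0 := by
  rw [stepDown_eq_zero (by norm_num) hx, stepDown_eq_zero (by norm_num) (by linarith : 19 / 20 ≤ x)]; ring

/-- **Band profile `≠ 0 ⟹ 17/20 < x < 18/5`.** [folklore] -/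
theorem mem_band_of_bandProfile_ne_zero {x : ℝ}
    (hx : smoothTransition ((18 / 5 - x) / (18 / 5 - 7 / 2)) - smoothTransition ((19 / 20 - x) / (19 / 20 - 17 / 20)) ≠ 0) :
    17 / 20 < x ∧ x < 18 / 5 := by
  constructor
  · by_contra hc; exact hx (bandProfile_eq_zero_of_le (not_lt.1 hc))
  · by_contra hc; exact hx (bandProfile_eq_zero_of_ge (not_lt.1 hc))

/-- **The band profile has compact support.** [folklore] -/
theorem hasCompactSupport_bandProfile :
    HasCompactSupport fun x : ℝ => smoothTransition ((18 / 5 - x) / (18 / 5 - 7 / 2)) - smoothTransition ((19 / 20 - x) / (19 / 20 - 17 / 20)) := by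
  refine HasCompactSupport.of_support_subset_isCompact (isCompact_Icc (a := 17 / 20) (b := 18 / 5)) fun x hx => ?_
  have h := mem_band_of_bandProfile_ne_zero (Function.mem_support.1 hx)
  exact ⟨h.1.le, h.2.le⟩

/-- **THE PARTITION IDENTITY**: `P_{7/2,18/5}(x) − P_{17/20,19/20}(x) = V(x) + V(−x)`. [folklore] -/
theorem plateau_sub_plateau_eq_band (x : ℝ) :
    (smoothTransition ((18 / 5 - x) / (18 / 5 - 7 / 2)) + smoothTransition ((18 / 5 + x) / (18 / 5 - 7 / 2)) - 1)
      - (smoothTransition ((19 / 20 - x) / (19 / 20 - 17 / 20)) + smoothTransition ((19 / 20 + x) / (19 / 20 - 17 / 20)) - 1)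
      = (smoothTransition ((18 / 5 - x) / (18 / 5 - 7 / 2)) - smoothTransition ((19 / 20 - x) / (19 / 20 - 17 / 20)))
        + (smoothTransition ((18 / 5 - -x) / (18 / 5 - 7 / 2)) - smoothTransition ((19 / 20 - -x) / (19 / 20 - 17 / 20))) := by
  rw [sub_neg_eq_add, sub_neg_eq_add]; ring

end Summit.NavierStokesRegularity.NavierStokesRegularity.Theorems.MatchedKernel

end
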